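import Summits.QuantumFields.BalabanUV.T4Continuum.Support.SubstrateChartRelatedPair
import Summits.QuantumFields.BalabanUV.T4Continuum.Support.SubstrateChartRealSlicePairSpeciesDecay

/-!
# SUBSTRATE — [dict] D-8 ∕ L-E14 follower W-20b: THE SPECIES ALONG THE RELATED SLICE WITH THE REAL-WINDOW CLAUSE — run A's and run B's Green operators and
# covariance entries (uniform `covBound` and W-9c decay-weighted bounds) at a RELATED chart point `relPair D (expChartT _ R⁰ A)`, real diameter in
# `relPair D '' W` (NE5 owner R52 (1): recursion chart OF RECORD = run-B coordinates, `emb := relPair D ∘ expChartT _ R⁰_B`, `real := relPair D '' window`)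

Cell `pub-balaban`, SUBSTRATE cell, seat `b2b-balaban-substrate-p1` (gen 5).  Summits-side under the LEAN PLACEMENT RULE.  Composition BY NAME of W-20
`SubstrateChartRelatedPair` (`resA`, `relPair`, `realWindow(OfRecord)`, `hslice_related_each`, `towerDataOf_transport`, `resA_mem_unitaryLev`) with the species letters
already used by W-17b∕W-17c: p223952 `analyticOnNhd_covAtTLev_printed_on_ballExplicit` ∕ `opNorm_greenT_le_on_ballExplicit` ∕ `rhoLev`, p225952
`analyticOnNhd_greenT_printed_on_ballExplicit`, W-15 `covBound` ∕ `norm_covAtTLev_le_on_ballExplicit`, W-9c `entryDecay_covAtTLev_chart_on_ballExplicit(_uniform)`,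
p223342 `coercive_vecOp_towerDataOf_of_regular`, p217365 `transV_mem_unitaryGroup`, p224186 `chi_expChartT_of_unitary`.  Nothing restated; 0 `def`.

WHY.  The landed pair species (W-17b `hslice_covAtTLev_pair₂`, W-17c `…_decay`) conclude `∃ γ z₀, …` with the real diameter in `unitaryLev₂ D`; the curve is hidden
behind the existential, so the window clause `γ x ∈ relPair D '' W` that g36-c's `real := Set.range ρ` needs at the instance (R52 (1)) cannot be recovered from
them.  This module re-derives the species packages along the RELATED slice from W-20's `hslice_related_each` — same letters, third clause in the window.

HONEST FRAMING: rung (B)+1 of the FINITE-VOLUME T⁴ programme — NOT infinite volume, NOT a mass gap, NOT Clay; spine PROVED 0∕9; NE5 NOT PRINTED ∕ NOT proved.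
Composition only, 0 estimate: `4∕γ` is p3's form-relative count, `covBound` W-15's crude explicit letter, the decay letters W-9c's; the small-field letters
`α τ a′`, `0 < gammaV`, the contour lengths and the torus sizes `≥ 2` are DISPLAYED; which window the rows deliver `hreal` on is the rows' (Q-NE23-W′); the
currency matching of the bounds against the format weights is the NE5 instancer's (R51 (2)).  HONEST DEPENDENCY (cell line, verbatim): continuum YM on T⁴ ⇐
BetaPertH ∧ nine spine estimates (0/9 proved); BetaPertH ⇐ (D1) ∧ (D4) ∧ CAP+tail; G-an2-4 gates asym, D1 and NE2/3/4.

WHAT ([folklore]).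
* §1 `hslice_related_chi_each` — W-20 `hslice_related_each` for families of the two-sided pairs read through `chi` on each factor (unitary run-B centre; run A's
  centre `resA D R⁰` is unitary by `resA_mem_unitaryLev`).
* §2 `rhoLev_succ_le` (run B's explicit radius is the smaller); generic unitary run-B centre `R⁰`, run A's letters AT `resA D R⁰`: **`hslice_greenT_related`** (`4∕γ_A`, `4∕γ_B`), **`hslice_covAtTLev_related`** (`covBound`),
  **`hslice_covAtTLev_related_decay`** (W-9c decay-weighted bounds) — each with the window clause `γ x ∈ relPair D '' W`, `W ⊇ realWindow _ R⁰ ((1 + r⁻¹)‖A‖)`.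
* §3 `regU_transport` ∕ `regT_transport` — run A's record letters `hU`∕`hT` AT THE TRANSPORTED FIELD follow from run B's (`hT` for a common contour family);
  AT A BACKGROUND OF RECORD `U : D.carriers.BgB` (unitary `ι` with `‖ι g − 1‖ = dist1 g`; W-17b's twelve record letters VERBATIM, run A's about
  `(D.carriers.transport U).1`): centre `towerDataOf _ ι D.avB U.1`, run A's centre `towerDataOf _ ι D.avA (D.carriers.transport U).1 = resA D (…)` by W-20
  `towerDataOf_transport`; **`hslice_greenT_related_record`**, **`hslice_covAtTLev_related_record`**, **`hslice_covAtTLev_related_decay_record`**, window `relPair D '' realWindowOfRecord D ι ϱ`.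
-/

noncomputable section

open scoped BigOperators ComplexConjugate Matrix Matrix.Norms.L2Operator Kronecker ComplexOrder
open Complex (I)

namespace Summit.QuantumFields.BalabanUV.T4Continuum.SubstrateChartRelatedPairSpecies

open Literature.MathematicalPhysics.QuantumFieldTheory.Balaban1983to89
open Literature.MathematicalPhysics.QuantumFieldTheory.Balaban1983to89.T4Continuum (T4Family)
open Literature.MathematicalPhysics.QuantumFieldTheory.Balaban1983to89.B5Prop11Plancherel (Tor fine)
open Literature.MathematicalPhysics.QuantumFieldTheory.Balaban1983to89.B5G183RateUnitTower (lev lev_neZero)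
open Literature.MathematicalPhysics.QuantumFieldTheory.Balaban1983to89.Beta.TorusG0Decay (ldist)
open Summit.QuantumFields.BalabanUV.T4Continuum
open Summit.QuantumFields.BalabanUV.T4Continuum.B13Carriers (TwoRuns.carriers_transport_val)
open Summit.QuantumFields.BalabanUV.T4Continuum.CoerciveInverseTower (Coercive)
open Summit.QuantumFields.BalabanUV.T4Continuum.CovariantVectorCoercive (vecOp gammaV)
open Summit.QuantumFields.BalabanUV.T4Continuum.CovariantBlockAveraging (ContourSystem transport)
open Summit.QuantumFields.BalabanUV.T4Continuum.CovariantVectorGreenDecayChartExplicit (kappaF)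
open Summit.QuantumFields.BalabanUV.T4Continuum.CovariantVectorCovarianceDecayBlocks (entryDecay_covAtTLev_chart_on_ballExplicit
  entryDecay_covAtTLev_chart_on_ballExplicit_uniform)
open Summit.QuantumFields.BalabanUV.T4Continuum.SubstrateBackgroundTransporters (unitMod transV_mem_unitaryGroup)
open Summit.QuantumFields.BalabanUV.T4Continuum.SubstrateTransporterSpecies
open Summit.QuantumFields.BalabanUV.T4Continuum.SubstrateTransporterSpeciesHolo (expChartT expChartInvT)
open Summit.QuantumFields.BalabanUV.T4Continuum.SubstrateTransporterSpeciesLev (cPr aPr covAtTLev coercive_vecOp_towerDataOf_of_regular)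
open Summit.QuantumFields.BalabanUV.T4Continuum.SubstrateTransporterSpeciesLevExplicit (rhoLev rhoLev_pos opNorm_greenT_le_on_ballExplicit
  analyticOnNhd_covAtTLev_printed_on_ballExplicit)
open Summit.QuantumFields.BalabanUV.T4Continuum.SubstrateChartSection (chi sectionOfRecord TwoRunChart chi_expChartT_of_unitary)
open Summit.QuantumFields.BalabanUV.T4Continuum.SubstrateChartRealSlice (unitaryLev towerDataOf_mem_unitaryLev)
open Summit.QuantumFields.BalabanUV.T4Continuum.SubstrateChartRealSliceSpecies (analyticOnNhd_greenT_printed_on_ballExplicit)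
open Summit.QuantumFields.BalabanUV.T4Continuum.SubstrateCovarianceChartBound (covBound norm_covAtTLev_le_on_ballExplicit)
open Summit.QuantumFields.BalabanUV.T4Continuum.SubstrateChartRelatedPair
open Summit.QuantumFields.BalabanUV.T4Continuum.SubstrateTwoRunsDriven (DrivenRuns)

variable {G : Type} [GaugeGroup G] (D : DrivenRuns G) {o : Type} [Fintype o] [DecidableEq o]

/-! ## §1 The related package for families of the two-sided pairs read through `chi` -/

/-- [folklore] **THE RELATED `hslice` PACKAGE FOR FAMILIES OF THE TWO-SIDED PAIRS READ THROUGH `chi` ON EACH FACTOR** (the substrate's species are functions of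
`(R, S)`): for a UNITARY run-B centre `R⁰` (so `resA D R⁰` is unitary and `chi` reads the exponential pairs on both factors), W-20 `hslice_related_each` with the
pull-backs rewritten by `chi_expChartT_of_unitary`; third clause in the window `relPair D '' W`, `W ⊇ realWindow _ R⁰ ((1 + r⁻¹)‖A‖)`. -/
theorem hslice_related_chi_each {EA EB : Type*} [NormedAddCommGroup EA] [NormedSpace ℂ EA] [NormedAddCommGroup EB] [NormedSpace ℂ EB]
    (GA : TowerData (D.F.P D.K) o × TowerData (D.F.P D.K) o → EA) (GB : TowerData (D.F.P (D.K + 1)) o × TowerData (D.F.P (D.K + 1)) o → EB)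
    {R₀ : TowerData (D.F.P (D.K + 1)) o} (hR₀ : R₀ ∈ unitaryLev (D.F.P (D.K + 1)) o) {ρA ρB CA CB r : ℝ} (hr : 0 < r)
    (hanA : AnalyticOnNhd ℂ (fun B => GA (expChartT _ (resA D R₀) B, expChartInvT _ (resA D R₀) B)) (Metric.ball 0 ρA))
    (hbdA : ∀ B ∈ Metric.ball 0 ρA, ‖GA (expChartT _ (resA D R₀) B, expChartInvT _ (resA D R₀) B)‖ ≤ CA)
    (hanB : AnalyticOnNhd ℂ (fun B => GB (expChartT _ R₀ B, expChartInvT _ R₀ B)) (Metric.ball 0 ρB))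
    (hbdB : ∀ B ∈ Metric.ball 0 ρB, ‖GB (expChartT _ R₀ B, expChartInvT _ R₀ B)‖ ≤ CB)
    (A : TowerData (D.F.P (D.K + 1)) o) (hA1 : (1 + r⁻¹) * ‖A‖ < ρA) (hA2 : (1 + r⁻¹) * ‖A‖ < ρB)
    {W : Set (TowerData (D.F.P (D.K + 1)) o)} (hW : realWindow _ R₀ ((1 + r⁻¹) * ‖A‖) ⊆ W) :
    ∃ γ : ℂ → TwoRunChart D o, ∃ z₀ : ℂ, ‖z₀‖ ≤ r ∧ γ z₀ = relPair D (expChartT _ R₀ A) ∧ (∀ x : ℝ, |x| < 1 → γ x ∈ relPair D '' W) ∧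
      DiffContOnCl ℂ (fun z => GA (chi _ (γ z).1)) (Metric.ball (0 : ℂ) 1) ∧ DiffContOnCl ℂ (fun z => GB (chi _ (γ z).2)) (Metric.ball (0 : ℂ) 1) ∧
      (∀ z : ℂ, ‖z‖ ≤ 1 → ‖GA (chi _ (γ z).1)‖ ≤ CA) ∧ ∀ z : ℂ, ‖z‖ ≤ 1 → ‖GB (chi _ (γ z).2)‖ ≤ CB := by
  have hRA : ∀ (k : Fin ((D.F.P D.K).K + 1)) ν i, resA D R₀ k ν i ∈ Matrix.unitaryGroup o ℂ := resA_mem_unitaryLev D hR₀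
  have h1 : (fun B => GA (chi _ (expChartT _ (resA D R₀) B))) = fun B => GA (expChartT _ (resA D R₀) B, expChartInvT _ (resA D R₀) B) :=
    funext fun B => by rw [chi_expChartT_of_unitary _ hRA]
  have h2 : (fun B => GB (chi _ (expChartT _ R₀ B))) = fun B => GB (expChartT _ R₀ B, expChartInvT _ R₀ B) :=
    funext fun B => by rw [chi_expChartT_of_unitary _ hR₀]
  exact hslice_related_each D (fun R => GA (chi _ R)) (fun R => GB (chi _ R)) hr (by rw [h1]; exact hanA)
    (fun B hB => by rw [chi_expChartT_of_unitary _ hRA]; exact hbdA B hB) (by rw [h2]; exact hanB)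
    (fun B hB => by rw [chi_expChartT_of_unitary _ hR₀]; exact hbdB B hB) A hA1 hA2 hW

/-! ## §2 The two runs' species along ONE related slice, generic unitary run-B centre -/

omit [DecidableEq o] in
/-- [folklore] **RUN B's EXPLICIT RADIUS IS THE SMALLER ONE** (`rhoLev_B = rhoStar ∕ L^{K+1} ≤ rhoStar ∕ L^K = rhoLev_A` for the same letters `γ a′`): a run-B coordinate
of run-B depth also has run-A depth — a consumer with equal letters keeps ONE smallness binder. -/
theorem rhoLev_succ_le {γ a' : ℝ} (ha' : 0 ≤ a') (hγ : 0 < γ) : rhoLev (D.F.P (D.K + 1)) (o := o) γ a' ≤ rhoLev (D.F.P D.K) (o := o) γ a' := by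
  unfold rhoLev
  refine div_le_div_of_nonneg_left (CovariantVectorCoerciveHoloForm.rhoStar_pos (d := (D.F.P D.K).d) ha' hγ _).le
    (Nat.cast_pos.2 (Nat.pos_of_ne_zero (NeZero.ne _))) ?_
  show ((lev (D.F.P D.K).L D.K : ℕ) : ℝ) ≤ ((D.F.P D.K).L * lev (D.F.P D.K).L D.K : ℕ)
  exact_mod_cast Nat.le_mul_of_pos_left _ (D.F.P D.K).L_pos

section Generic

variable [Nonempty o]
variable (ΓA : (k : ℕ) → ContourSystem (D.F.P D.K).d (lev (D.F.P D.K).L k) (unitMod (D.F.P D.K)))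
  (ΓB : (k : ℕ) → ContourSystem (D.F.P (D.K + 1)).d (lev (D.F.P (D.K + 1)).L k) (unitMod (D.F.P (D.K + 1))))
variable {R₀ : TowerData (D.F.P (D.K + 1)) o} (hR₀ : R₀ ∈ unitaryLev (D.F.P (D.K + 1)) o)
  {aA γA aB γB : ℝ} (haA : 0 ≤ aA) (haB : 0 ≤ aB)
  (hcoA : ∀ k : Fin ((D.F.P D.K).K + 1), Coercive γA (vecOp (lev (D.F.P D.K).L k) (unitMod (D.F.P D.K)) aA (ΓA k) (resA D R₀ k)))
  (hcoB : ∀ k : Fin ((D.F.P (D.K + 1)).K + 1), Coercive γB (vecOp (lev (D.F.P (D.K + 1)).L k) (unitMod (D.F.P (D.K + 1))) aB (ΓB k) (R₀ k)))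
  (hγA : 0 < γA) (hγB : 0 < γB)
  {ℓA : Fin ((D.F.P D.K).K + 1) → ℕ} {ℓB : Fin ((D.F.P (D.K + 1)).K + 1) → ℕ}
  (hΓA : ∀ (k : Fin ((D.F.P D.K).K + 1)) y j μ (t : Fin (lev (D.F.P D.K).L k)), (ΓA k y j μ t).length ≤ ℓA k)
  (hΓB : ∀ (k : Fin ((D.F.P (D.K + 1)).K + 1)) y j μ (t : Fin (lev (D.F.P (D.K + 1)).L k)), (ΓB k y j μ t).length ≤ ℓB k)
  (hℓA : ∀ k : Fin ((D.F.P D.K).K + 1), (ℓA k : ℝ) ≤ (((D.F.P D.K).d : ℝ) + 1) * (lev (D.F.P D.K).L k : ℕ))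
  (hℓB : ∀ k : Fin ((D.F.P (D.K + 1)).K + 1), (ℓB k : ℝ) ≤ (((D.F.P (D.K + 1)).d : ℝ) + 1) * (lev (D.F.P (D.K + 1)).L k : ℕ))

include hR₀ haA haB hcoA hcoB hγA hγB hΓA hΓB hℓA hℓB in
/-- [folklore] **RUN A's AND RUN B's GREEN OPERATORS ALONG ONE RELATED SLICE — ALL SEVEN CLAUSES, WINDOW FORM** (bounds `4∕γ_A`, `4∕γ_B`): unitary run-B centre
`R⁰`, run A's letters at `resA D R⁰`, ONE run-B coordinate `A` with `(1 + r⁻¹)‖A‖ < rhoLev_A`, `< rhoLev_B`, real diameter in `relPair D '' W`. -/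
theorem hslice_greenT_related {r : ℝ} (hr : 0 < r) (kA : Fin ((D.F.P D.K).K + 1)) (kB : Fin ((D.F.P (D.K + 1)).K + 1))
    (A : TowerData (D.F.P (D.K + 1)) o) (hA1 : (1 + r⁻¹) * ‖A‖ < rhoLev (D.F.P D.K) (o := o) γA aA)
    (hA2 : (1 + r⁻¹) * ‖A‖ < rhoLev (D.F.P (D.K + 1)) (o := o) γB aB)
    {W : Set (TowerData (D.F.P (D.K + 1)) o)} (hW : realWindow _ R₀ ((1 + r⁻¹) * ‖A‖) ⊆ W) :
    ∃ γ : ℂ → TwoRunChart D o, ∃ z₀ : ℂ, ‖z₀‖ ≤ r ∧ γ z₀ = relPair D (expChartT _ R₀ A) ∧ (∀ x : ℝ, |x| < 1 → γ x ∈ relPair D '' W) ∧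
      DiffContOnCl ℂ (fun z => greenT (lev (D.F.P D.K).L kA) (unitMod (D.F.P D.K)) (cPr (D.F.P D.K) kA) (aPr (D.F.P D.K) aA kA) (ΓA kA)
        ((chi _ (γ z).1).1 kA) ((chi _ (γ z).1).2 kA)) (Metric.ball (0 : ℂ) 1) ∧
      DiffContOnCl ℂ (fun z => greenT (lev (D.F.P (D.K + 1)).L kB) (unitMod (D.F.P (D.K + 1))) (cPr (D.F.P (D.K + 1)) kB) (aPr (D.F.P (D.K + 1)) aB kB)
        (ΓB kB) ((chi _ (γ z).2).1 kB) ((chi _ (γ z).2).2 kB)) (Metric.ball (0 : ℂ) 1) ∧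
      (∀ z : ℂ, ‖z‖ ≤ 1 → ‖greenT (lev (D.F.P D.K).L kA) (unitMod (D.F.P D.K)) (cPr (D.F.P D.K) kA) (aPr (D.F.P D.K) aA kA) (ΓA kA)
        ((chi _ (γ z).1).1 kA) ((chi _ (γ z).1).2 kA)‖ ≤ 4 / γA) ∧
      ∀ z : ℂ, ‖z‖ ≤ 1 → ‖greenT (lev (D.F.P (D.K + 1)).L kB) (unitMod (D.F.P (D.K + 1))) (cPr (D.F.P (D.K + 1)) kB) (aPr (D.F.P (D.K + 1)) aB kB)
        (ΓB kB) ((chi _ (γ z).2).1 kB) ((chi _ (γ z).2).2 kB)‖ ≤ 4 / γB :=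
  have hRA : ∀ (k : Fin ((D.F.P D.K).K + 1)) ν i, resA D R₀ k ν i ∈ Matrix.unitaryGroup o ℂ := resA_mem_unitaryLev D hR₀
  hslice_related_chi_each D
    (fun RS => greenT (lev (D.F.P D.K).L kA) (unitMod (D.F.P D.K)) (cPr (D.F.P D.K) kA) (aPr (D.F.P D.K) aA kA) (ΓA kA) (RS.1 kA) (RS.2 kA))
    (fun RS => greenT (lev (D.F.P (D.K + 1)).L kB) (unitMod (D.F.P (D.K + 1))) (cPr (D.F.P (D.K + 1)) kB) (aPr (D.F.P (D.K + 1)) aB kB) (ΓB kB)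
      (RS.1 kB) (RS.2 kB)) hR₀ hr
    (analyticOnNhd_greenT_printed_on_ballExplicit _ ΓA hRA haA hcoA hγA hΓA hℓA kA)
    (fun _ hB => opNorm_greenT_le_on_ballExplicit _ ΓA hRA haA hcoA hγA hΓA hℓA hB kA)
    (analyticOnNhd_greenT_printed_on_ballExplicit _ ΓB hR₀ haB hcoB hγB hΓB hℓB kB)
    (fun _ hB => opNorm_greenT_le_on_ballExplicit _ ΓB hR₀ haB hcoB hγB hΓB hℓB hB kB) A hA1 hA2 hW

variable (sA sB : ℕ → ℂ)

include hR₀ haA haB hcoA hcoB hγA hγB hΓA hΓB hℓA hℓB in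
/-- [folklore] **RUN A's AND RUN B's COVARIANCE ENTRIES ALONG ONE RELATED SLICE — ALL SEVEN CLAUSES, WINDOW FORM** (bounds W-15's `covBound` per run). -/
theorem hslice_covAtTLev_related {r : ℝ} (hr : 0 < r) (kA kB : ℕ) {TA TB : Type*} (tA : TA) (tB : TB)
    (bA bA' : (Tor (unitMod (D.F.P D.K)) × Fin (D.F.P D.K).d) × o) (bB bB' : (Tor (unitMod (D.F.P (D.K + 1))) × Fin (D.F.P (D.K + 1)).d) × o)
    (A : TowerData (D.F.P (D.K + 1)) o) (hA1 : (1 + r⁻¹) * ‖A‖ < rhoLev (D.F.P D.K) (o := o) γA aA)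
    (hA2 : (1 + r⁻¹) * ‖A‖ < rhoLev (D.F.P (D.K + 1)) (o := o) γB aB)
    {W : Set (TowerData (D.F.P (D.K + 1)) o)} (hW : realWindow _ R₀ ((1 + r⁻¹) * ‖A‖) ⊆ W) :
    ∃ γ : ℂ → TwoRunChart D o, ∃ z₀ : ℂ, ‖z₀‖ ≤ r ∧ γ z₀ = relPair D (expChartT _ R₀ A) ∧ (∀ x : ℝ, |x| < 1 → γ x ∈ relPair D '' W) ∧
      DiffContOnCl ℂ (fun z => covAtTLev (D.F.P D.K) (cPr (D.F.P D.K)) (aPr (D.F.P D.K) aA) ΓA sA (chi _ (γ z).1).1 (chi _ (γ z).1).2 kA tA bA bA')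
        (Metric.ball (0 : ℂ) 1) ∧
      DiffContOnCl ℂ (fun z => covAtTLev (D.F.P (D.K + 1)) (cPr (D.F.P (D.K + 1))) (aPr (D.F.P (D.K + 1)) aB) ΓB sB (chi _ (γ z).2).1 (chi _ (γ z).2).2
        kB tB bB bB') (Metric.ball (0 : ℂ) 1) ∧
      (∀ z : ℂ, ‖z‖ ≤ 1 → ‖covAtTLev (D.F.P D.K) (cPr (D.F.P D.K)) (aPr (D.F.P D.K) aA) ΓA sA (chi _ (γ z).1).1 (chi _ (γ z).1).2 kA tA bA bA'‖
        ≤ covBound (D.F.P D.K) o γA sA kA) ∧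
      ∀ z : ℂ, ‖z‖ ≤ 1 → ‖covAtTLev (D.F.P (D.K + 1)) (cPr (D.F.P (D.K + 1))) (aPr (D.F.P (D.K + 1)) aB) ΓB sB (chi _ (γ z).2).1 (chi _ (γ z).2).2
        kB tB bB bB'‖ ≤ covBound (D.F.P (D.K + 1)) o γB sB kB :=
  have hRA : ∀ (k : Fin ((D.F.P D.K).K + 1)) ν i, resA D R₀ k ν i ∈ Matrix.unitaryGroup o ℂ := resA_mem_unitaryLev D hR₀
  hslice_related_chi_each D
    (fun RS => covAtTLev (D.F.P D.K) (cPr (D.F.P D.K)) (aPr (D.F.P D.K) aA) ΓA sA RS.1 RS.2 kA tA bA bA')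
    (fun RS => covAtTLev (D.F.P (D.K + 1)) (cPr (D.F.P (D.K + 1))) (aPr (D.F.P (D.K + 1)) aB) ΓB sB RS.1 RS.2 kB tB bB bB') hR₀ hr
    (analyticOnNhd_covAtTLev_printed_on_ballExplicit _ ΓA hRA haA hcoA hγA hΓA hℓA sA kA tA bA bA')
    (fun _ hB => norm_covAtTLev_le_on_ballExplicit _ ΓA hRA haA hcoA hγA hΓA hℓA sA kA tA bA bA' hB)
    (analyticOnNhd_covAtTLev_printed_on_ballExplicit _ ΓB hR₀ haB hcoB hγB hΓB hℓB sB kB tB bB bB')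
    (fun _ hB => norm_covAtTLev_le_on_ballExplicit _ ΓB hR₀ haB hcoB hγB hΓB hℓB sB kB tB bB bB' hB) A hA1 hA2 hW

include hR₀ haA haB hcoA hcoB hγA hγB hΓA hΓB hℓA hℓB in
/-- [folklore] **THE SAME WITH W-9c's DECAY-WEIGHTED CLOSED-DISC BOUNDS** (torus sizes `≥ 2` displayed; `κ_i = kappaF |o| d a′_i γ_i`). -/
theorem hslice_covAtTLev_related_decay
    (h2A : ∀ (k : Fin ((D.F.P D.K).K + 1)) μ, 2 ≤ fine (lev (D.F.P D.K).L k) (unitMod (D.F.P D.K)) μ)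
    (h2B : ∀ (k : Fin ((D.F.P (D.K + 1)).K + 1)) μ, 2 ≤ fine (lev (D.F.P (D.K + 1)).L k) (unitMod (D.F.P (D.K + 1))) μ)
    {r : ℝ} (hr : 0 < r) (kA kB : ℕ) {TA TB : Type*} (tA : TA) (tB : TB)
    (bA bA' : (Tor (unitMod (D.F.P D.K)) × Fin (D.F.P D.K).d) × o) (bB bB' : (Tor (unitMod (D.F.P (D.K + 1))) × Fin (D.F.P (D.K + 1)).d) × o)
    (A : TowerData (D.F.P (D.K + 1)) o) (hA1 : (1 + r⁻¹) * ‖A‖ < rhoLev (D.F.P D.K) (o := o) γA aA)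
    (hA2 : (1 + r⁻¹) * ‖A‖ < rhoLev (D.F.P (D.K + 1)) (o := o) γB aB)
    {W : Set (TowerData (D.F.P (D.K + 1)) o)} (hW : realWindow _ R₀ ((1 + r⁻¹) * ‖A‖) ⊆ W) :
    ∃ γ : ℂ → TwoRunChart D o, ∃ z₀ : ℂ, ‖z₀‖ ≤ r ∧ γ z₀ = relPair D (expChartT _ R₀ A) ∧ (∀ x : ℝ, |x| < 1 → γ x ∈ relPair D '' W) ∧
      DiffContOnCl ℂ (fun z => covAtTLev (D.F.P D.K) (cPr (D.F.P D.K)) (aPr (D.F.P D.K) aA) ΓA sA (chi _ (γ z).1).1 (chi _ (γ z).1).2 kA tA bA bA')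
        (Metric.ball (0 : ℂ) 1) ∧
      DiffContOnCl ℂ (fun z => covAtTLev (D.F.P (D.K + 1)) (cPr (D.F.P (D.K + 1))) (aPr (D.F.P (D.K + 1)) aB) ΓB sB (chi _ (γ z).2).1 (chi _ (γ z).2).2
        kB tB bB bB') (Metric.ball (0 : ℂ) 1) ∧
      (∀ z : ℂ, ‖z‖ ≤ 1 → ‖covAtTLev (D.F.P D.K) (cPr (D.F.P D.K)) (aPr (D.F.P D.K) aA) ΓA sA (chi _ (γ z).1).1 (chi _ (γ z).1).2 kA tA bA bA'‖
        ≤ (‖sA kA‖ * (16 * Fintype.card o * (((lev (D.F.P D.K).L kA : ℕ) : ℝ) ^ (D.F.P D.K).d)⁻¹) * (8 / γA) *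
            Real.exp (2 * kappaF (Fintype.card o) (D.F.P D.K).d aA γA)) *
          Real.exp (-(kappaF (Fintype.card o) (D.F.P D.K).d aA γA * ldist (unitMod (D.F.P D.K)) bA.1.1 bA'.1.1))) ∧
      ∀ z : ℂ, ‖z‖ ≤ 1 → ‖covAtTLev (D.F.P (D.K + 1)) (cPr (D.F.P (D.K + 1))) (aPr (D.F.P (D.K + 1)) aB) ΓB sB (chi _ (γ z).2).1 (chi _ (γ z).2).2
        kB tB bB bB'‖
        ≤ (‖sB kB‖ * (16 * Fintype.card o * (((lev (D.F.P (D.K + 1)).L kB : ℕ) : ℝ) ^ (D.F.P (D.K + 1)).d)⁻¹) * (8 / γB) *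
            Real.exp (2 * kappaF (Fintype.card o) (D.F.P (D.K + 1)).d aB γB)) *
          Real.exp (-(kappaF (Fintype.card o) (D.F.P (D.K + 1)).d aB γB * ldist (unitMod (D.F.P (D.K + 1))) bB.1.1 bB'.1.1)) :=
  have hRA : ∀ (k : Fin ((D.F.P D.K).K + 1)) ν i, resA D R₀ k ν i ∈ Matrix.unitaryGroup o ℂ := resA_mem_unitaryLev D hR₀
  hslice_related_chi_each D
    (fun RS => covAtTLev (D.F.P D.K) (cPr (D.F.P D.K)) (aPr (D.F.P D.K) aA) ΓA sA RS.1 RS.2 kA tA bA bA')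
    (fun RS => covAtTLev (D.F.P (D.K + 1)) (cPr (D.F.P (D.K + 1))) (aPr (D.F.P (D.K + 1)) aB) ΓB sB RS.1 RS.2 kB tB bB bB') hR₀ hr
    (analyticOnNhd_covAtTLev_printed_on_ballExplicit _ ΓA hRA haA hcoA hγA hΓA hℓA sA kA tA bA bA')
    (fun _ hB => entryDecay_covAtTLev_chart_on_ballExplicit _ ΓA hRA haA hcoA hγA hΓA hℓA h2A sA kA tA hB bA bA')
    (analyticOnNhd_covAtTLev_printed_on_ballExplicit _ ΓB hR₀ haB hcoB hγB hΓB hℓB sB kB tB bB bB')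
    (fun _ hB => entryDecay_covAtTLev_chart_on_ballExplicit _ ΓB hR₀ haB hcoB hγB hΓB hℓB h2B sB kB tB hB bB bB') A hA1 hA2 hW

end Generic

/-! ## §3 At a background of record: centre = run B's tower of record of `U`, run A's letters at the transported field -/

section Letters

variable (ι : G →* Matrix o o ℂ) (U : D.carriers.BgB)

/-- [folklore] **RUN A's SMALL-FIELD LETTER AT THE TRANSPORTED FIELD FOLLOWS FROM RUN B's** (the `hU` binder of `coercive_vecOp_towerDataOf_of_regular` ∕ W-17b §3):
the averages of `D.carriers.transport U` ARE run B's averages of `U` one level up (`DrivenRuns.iter_transportRaw`), read bond by bond through `bondShift`. -/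
theorem regU_transport {α : ℝ}
    (hUB : ∀ (k : Fin ((D.F.P (D.K + 1)).K + 1)) (b : PBond (D.F.P (D.K + 1)) ((D.F.P (D.K + 1)).K - k)),
      ((lev (D.F.P (D.K + 1)).L k : ℕ) : ℝ) * dist1 (Averaging.iter D.avB ((D.F.P (D.K + 1)).K - k) U.1 b) ≤ α)
    (k : Fin ((D.F.P D.K).K + 1)) (b : PBond (D.F.P D.K) ((D.F.P D.K).K - k)) :
    ((lev (D.F.P D.K).L k : ℕ) : ℝ) * dist1 (Averaging.iter D.avA ((D.F.P D.K).K - k) (D.carriers.transport U).1 b) ≤ α := by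
  have aux : ∀ {j j' : ℕ} (_ : j = j'),
      (∀ b' : PBond (D.F.P (D.K + 1)) j, ((lev (D.F.P D.K).L k : ℕ) : ℝ) * dist1 (Averaging.iter D.avB j U.1 b') ≤ α) →
        ∀ b' : PBond (D.F.P (D.K + 1)) j', ((lev (D.F.P D.K).L k : ℕ) : ℝ) * dist1 (Averaging.iter D.avB j' U.1 b') ≤ α := by
    rintro j j' rfl h; exact h
  rw [TwoRuns.carriers_transport_val, D.iter_transportRaw, T4LevelShift.ladderShift_eq, T4LevelShift.fieldShift_apply]
  exact aux (by have := k.2; simp only [T4Family.P_K] at this ⊢; omega) (fun b' => hUB ⟨k.1, lt_levels_succ D k⟩ b') _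

/-- [folklore] **RUN A's CONTOUR LETTER AT THE TRANSPORTED FIELD FOLLOWS FROM RUN B's** for a COMMON contour-system family `Γ` at aligned levels (the `hT` binder):
run A's tower of record of the transported field is `resA D` of run B's (W-20 `towerDataOf_transport`). -/
theorem regT_transport (Γ : (k : ℕ) → ContourSystem (D.F.P (D.K + 1)).d (lev (D.F.P (D.K + 1)).L k) (unitMod (D.F.P (D.K + 1)))) {τ : ℝ}
    (hTB : ∀ (k : Fin ((D.F.P (D.K + 1)).K + 1)) y jj μ (t : Fin (lev (D.F.P (D.K + 1)).L k)),
      ‖transport (fine (lev (D.F.P (D.K + 1)).L k) (unitMod (D.F.P (D.K + 1)))) (towerDataOf (D.F.P (D.K + 1)) ι D.avB U.1 k) μ (Γ k y jj μ t) - 1‖ ≤ τ)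
    (k : Fin ((D.F.P D.K).K + 1)) (y : Tor (unitMod (D.F.P D.K))) (jj : Fin (D.F.P D.K).d → Fin (lev (D.F.P D.K).L k)) (μ : Fin (D.F.P D.K).d)
    (t : Fin (lev (D.F.P D.K).L k)) :
    ‖transport (fine (lev (D.F.P D.K).L k) (unitMod (D.F.P D.K))) (towerDataOf (D.F.P D.K) ι D.avA (D.carriers.transport U).1 k) μ (Γ k y jj μ t) - 1‖ ≤ τ := by
  rw [TwoRuns.carriers_transport_val, towerDataOf_transport]
  exact hTB ⟨k.1, lt_levels_succ D k⟩ y jj μ t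

end Letters

section Record

variable [Nonempty o]
variable (ΓA : (k : ℕ) → ContourSystem (D.F.P D.K).d (lev (D.F.P D.K).L k) (unitMod (D.F.P D.K)))
  (ΓB : (k : ℕ) → ContourSystem (D.F.P (D.K + 1)).d (lev (D.F.P (D.K + 1)).L k) (unitMod (D.F.P (D.K + 1))))
variable (ι : G →* Matrix o o ℂ) (hι : ∀ g, ι g ∈ Matrix.unitaryGroup o ℂ) (hdist : ∀ g : G, ‖ι g - 1‖ = dist1 g) (U : D.carriers.BgB)
  {aA αA τA aB αB τB : ℝ} (haA : 0 < aA) (hαA : 0 ≤ αA) (hτA : 0 ≤ τA) (haB : 0 < aB) (hαB : 0 ≤ αB) (hτB : 0 ≤ τB)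
  (hUA : ∀ (k : Fin ((D.F.P D.K).K + 1)) (b : PBond (D.F.P D.K) ((D.F.P D.K).K - k)),
    ((lev (D.F.P D.K).L k : ℕ) : ℝ) * dist1 (Averaging.iter D.avA ((D.F.P D.K).K - k) (D.carriers.transport U).1 b) ≤ αA)
  (hTA : ∀ (k : Fin ((D.F.P D.K).K + 1)) y jj μ (t : Fin (lev (D.F.P D.K).L k)),
    ‖transport (fine (lev (D.F.P D.K).L k) (unitMod (D.F.P D.K))) (towerDataOf (D.F.P D.K) ι D.avA (D.carriers.transport U).1 k) μ (ΓA k y jj μ t) - 1‖ ≤ τA)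
  (hUB : ∀ (k : Fin ((D.F.P (D.K + 1)).K + 1)) (b : PBond (D.F.P (D.K + 1)) ((D.F.P (D.K + 1)).K - k)),
    ((lev (D.F.P (D.K + 1)).L k : ℕ) : ℝ) * dist1 (Averaging.iter D.avB ((D.F.P (D.K + 1)).K - k) U.1 b) ≤ αB)
  (hTB : ∀ (k : Fin ((D.F.P (D.K + 1)).K + 1)) y jj μ (t : Fin (lev (D.F.P (D.K + 1)).L k)),
    ‖transport (fine (lev (D.F.P (D.K + 1)).L k) (unitMod (D.F.P (D.K + 1)))) (towerDataOf (D.F.P (D.K + 1)) ι D.avB U.1 k) μ (ΓB k y jj μ t) - 1‖ ≤ τB)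
  (hγVA : 0 < gammaV (Fintype.card o) (D.F.P D.K).d aA αA τA) (hγVB : 0 < gammaV (Fintype.card o) (D.F.P (D.K + 1)).d aB αB τB)
  {ℓA : Fin ((D.F.P D.K).K + 1) → ℕ} {ℓB : Fin ((D.F.P (D.K + 1)).K + 1) → ℕ}
  (hΓA : ∀ (k : Fin ((D.F.P D.K).K + 1)) y j μ (t : Fin (lev (D.F.P D.K).L k)), (ΓA k y j μ t).length ≤ ℓA k)
  (hΓB : ∀ (k : Fin ((D.F.P (D.K + 1)).K + 1)) y j μ (t : Fin (lev (D.F.P (D.K + 1)).L k)), (ΓB k y j μ t).length ≤ ℓB k)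
  (hℓA : ∀ k : Fin ((D.F.P D.K).K + 1), (ℓA k : ℝ) ≤ (((D.F.P D.K).d : ℝ) + 1) * (lev (D.F.P D.K).L k : ℕ))
  (hℓB : ∀ k : Fin ((D.F.P (D.K + 1)).K + 1), (ℓB k : ℝ) ≤ (((D.F.P (D.K + 1)).d : ℝ) + 1) * (lev (D.F.P (D.K + 1)).L k : ℕ))
  (sA sB : ℕ → ℂ)

include hι hdist haA hαA hτA haB hαB hτB hUA hTA hUB hTB hγVA hγVB hΓA hΓB hℓA hℓB in
/-- [folklore] **THE TWO RUNS' GREEN OPERATORS ALONG ONE RELATED SLICE AT A BACKGROUND OF RECORD** (levels `kA kB`; bounds `4∕gammaV_A`, `4∕gammaV_B`;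
centre `towerDataOf _ ι D.avB U.1`, run A's letters on `(D.carriers.transport U).1` transported by W-20 `towerDataOf_transport`; window of record). -/
theorem hslice_greenT_related_record {r : ℝ} (hr : 0 < r) (kA : Fin ((D.F.P D.K).K + 1)) (kB : Fin ((D.F.P (D.K + 1)).K + 1))
    (A : TowerData (D.F.P (D.K + 1)) o) (hA1 : (1 + r⁻¹) * ‖A‖ < rhoLev (D.F.P D.K) (o := o) (gammaV (Fintype.card o) (D.F.P D.K).d aA αA τA) aA)
    (hA2 : (1 + r⁻¹) * ‖A‖ < rhoLev (D.F.P (D.K + 1)) (o := o) (gammaV (Fintype.card o) (D.F.P (D.K + 1)).d aB αB τB) aB)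
    {ϱ : ℝ} (hϱ : (1 + r⁻¹) * ‖A‖ ≤ ϱ) :
    ∃ γ : ℂ → TwoRunChart D o, ∃ z₀ : ℂ, ‖z₀‖ ≤ r ∧ γ z₀ = relPair D (expChartT _ (towerDataOf (D.F.P (D.K + 1)) ι D.avB U.1) A) ∧
      (∀ x : ℝ, |x| < 1 → γ x ∈ relPair D '' realWindowOfRecord D ι ϱ) ∧
      DiffContOnCl ℂ (fun z => greenT (lev (D.F.P D.K).L kA) (unitMod (D.F.P D.K)) (cPr (D.F.P D.K) kA) (aPr (D.F.P D.K) aA kA) (ΓA kA)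
        ((chi _ (γ z).1).1 kA) ((chi _ (γ z).1).2 kA)) (Metric.ball (0 : ℂ) 1) ∧
      DiffContOnCl ℂ (fun z => greenT (lev (D.F.P (D.K + 1)).L kB) (unitMod (D.F.P (D.K + 1))) (cPr (D.F.P (D.K + 1)) kB) (aPr (D.F.P (D.K + 1)) aB kB)
        (ΓB kB) ((chi _ (γ z).2).1 kB) ((chi _ (γ z).2).2 kB)) (Metric.ball (0 : ℂ) 1) ∧
      (∀ z : ℂ, ‖z‖ ≤ 1 → ‖greenT (lev (D.F.P D.K).L kA) (unitMod (D.F.P D.K)) (cPr (D.F.P D.K) kA) (aPr (D.F.P D.K) aA kA) (ΓA kA)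
        ((chi _ (γ z).1).1 kA) ((chi _ (γ z).1).2 kA)‖ ≤ 4 / gammaV (Fintype.card o) (D.F.P D.K).d aA αA τA) ∧
      ∀ z : ℂ, ‖z‖ ≤ 1 → ‖greenT (lev (D.F.P (D.K + 1)).L kB) (unitMod (D.F.P (D.K + 1))) (cPr (D.F.P (D.K + 1)) kB) (aPr (D.F.P (D.K + 1)) aB kB)
        (ΓB kB) ((chi _ (γ z).2).1 kB) ((chi _ (γ z).2).2 kB)‖ ≤ 4 / gammaV (Fintype.card o) (D.F.P (D.K + 1)).d aB αB τB := by
  have hcoA := coercive_vecOp_towerDataOf_of_regular _ ΓA ι D.avA hdist (D.carriers.transport U).1 haA hαA hτA hUA hTA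
  rw [TwoRuns.carriers_transport_val, towerDataOf_transport] at hcoA
  exact hslice_greenT_related D ΓA ΓB (towerDataOf_mem_unitaryLev _ ι D.avB hι U.1) haA.le haB.le hcoA
    (coercive_vecOp_towerDataOf_of_regular _ ΓB ι D.avB hdist U.1 haB hαB hτB hUB hTB) hγVA hγVB hΓA hΓB hℓA hℓB hr kA kB A hA1 hA2
    ((realWindow_mono _ _ hϱ).trans (realWindow_subset_realWindowOfRecord D ι U ϱ))

include hι hdist haA hαA hτA haB hαB hτB hUA hTA hUB hTB hγVA hγVB hΓA hΓB hℓA hℓB in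
/-- [folklore] **THE TWO RUNS' COVARIANCE ENTRIES ALONG ONE RELATED SLICE AT A BACKGROUND OF RECORD** (centre `towerDataOf _ ι D.avB U.1`; run A's letters displayed on
the transported field `(D.carriers.transport U).1`, whose tower of record IS `resA D` of run B's — W-20 `towerDataOf_transport`): `hslice_covAtTLev_related` with
`γ_i := gammaV_i`, the coercivity of both centres by `coercive_vecOp_towerDataOf_of_regular`, any depth `ϱ ≥ (1 + r⁻¹)‖A‖`, window `relPair D '' realWindowOfRecord D ι ϱ`. -/
theorem hslice_covAtTLev_related_record {r : ℝ} (hr : 0 < r) (kA kB : ℕ) {TA TB : Type*} (tA : TA) (tB : TB)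
    (bA bA' : (Tor (unitMod (D.F.P D.K)) × Fin (D.F.P D.K).d) × o) (bB bB' : (Tor (unitMod (D.F.P (D.K + 1))) × Fin (D.F.P (D.K + 1)).d) × o)
    (A : TowerData (D.F.P (D.K + 1)) o) (hA1 : (1 + r⁻¹) * ‖A‖ < rhoLev (D.F.P D.K) (o := o) (gammaV (Fintype.card o) (D.F.P D.K).d aA αA τA) aA)
    (hA2 : (1 + r⁻¹) * ‖A‖ < rhoLev (D.F.P (D.K + 1)) (o := o) (gammaV (Fintype.card o) (D.F.P (D.K + 1)).d aB αB τB) aB)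
    {ϱ : ℝ} (hϱ : (1 + r⁻¹) * ‖A‖ ≤ ϱ) :
    ∃ γ : ℂ → TwoRunChart D o, ∃ z₀ : ℂ, ‖z₀‖ ≤ r ∧ γ z₀ = relPair D (expChartT _ (towerDataOf (D.F.P (D.K + 1)) ι D.avB U.1) A) ∧
      (∀ x : ℝ, |x| < 1 → γ x ∈ relPair D '' realWindowOfRecord D ι ϱ) ∧
      DiffContOnCl ℂ (fun z => covAtTLev (D.F.P D.K) (cPr (D.F.P D.K)) (aPr (D.F.P D.K) aA) ΓA sA (chi _ (γ z).1).1 (chi _ (γ z).1).2 kA tA bA bA')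
        (Metric.ball (0 : ℂ) 1) ∧
      DiffContOnCl ℂ (fun z => covAtTLev (D.F.P (D.K + 1)) (cPr (D.F.P (D.K + 1))) (aPr (D.F.P (D.K + 1)) aB) ΓB sB (chi _ (γ z).2).1 (chi _ (γ z).2).2
        kB tB bB bB') (Metric.ball (0 : ℂ) 1) ∧
      (∀ z : ℂ, ‖z‖ ≤ 1 → ‖covAtTLev (D.F.P D.K) (cPr (D.F.P D.K)) (aPr (D.F.P D.K) aA) ΓA sA (chi _ (γ z).1).1 (chi _ (γ z).1).2 kA tA bA bA'‖
        ≤ covBound (D.F.P D.K) o (gammaV (Fintype.card o) (D.F.P D.K).d aA αA τA) sA kA) ∧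
      ∀ z : ℂ, ‖z‖ ≤ 1 → ‖covAtTLev (D.F.P (D.K + 1)) (cPr (D.F.P (D.K + 1))) (aPr (D.F.P (D.K + 1)) aB) ΓB sB (chi _ (γ z).2).1 (chi _ (γ z).2).2
        kB tB bB bB'‖ ≤ covBound (D.F.P (D.K + 1)) o (gammaV (Fintype.card o) (D.F.P (D.K + 1)).d aB αB τB) sB kB := by
  have hcoA := coercive_vecOp_towerDataOf_of_regular _ ΓA ι D.avA hdist (D.carriers.transport U).1 haA hαA hτA hUA hTA
  rw [TwoRuns.carriers_transport_val, towerDataOf_transport] at hcoA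
  exact hslice_covAtTLev_related D ΓA ΓB (towerDataOf_mem_unitaryLev _ ι D.avB hι U.1) haA.le haB.le hcoA
    (coercive_vecOp_towerDataOf_of_regular _ ΓB ι D.avB hdist U.1 haB hαB hτB hUB hTB) hγVA hγVB hΓA hΓB hℓA hℓB sA sB hr kA kB tA tB bA bA' bB bB'
    A hA1 hA2 ((realWindow_mono _ _ hϱ).trans (realWindow_subset_realWindowOfRecord D ι U ϱ))

include hι hdist haA hαA hτA haB hαB hτB hUA hTA hUB hTB hγVA hγVB hΓA hΓB hℓA hℓB in
/-- [folklore] **THE SAME WITH W-9c's DECAY-WEIGHTED CLOSED-DISC BOUNDS** (torus sizes `≥ 2` displayed; rates `κ_i = kappaF |o| d a′_i (gammaV_i)`) — the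
decay-weighted currency of R51's ADDENDUM (g36-c's `InFormat` supplier for the covariance species), window `relPair D '' realWindowOfRecord D ι ϱ`. -/
theorem hslice_covAtTLev_related_decay_record
    (h2A : ∀ (k : Fin ((D.F.P D.K).K + 1)) μ, 2 ≤ fine (lev (D.F.P D.K).L k) (unitMod (D.F.P D.K)) μ)
    (h2B : ∀ (k : Fin ((D.F.P (D.K + 1)).K + 1)) μ, 2 ≤ fine (lev (D.F.P (D.K + 1)).L k) (unitMod (D.F.P (D.K + 1))) μ)
    {r : ℝ} (hr : 0 < r) (kA kB : ℕ) {TA TB : Type*} (tA : TA) (tB : TB)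
    (bA bA' : (Tor (unitMod (D.F.P D.K)) × Fin (D.F.P D.K).d) × o) (bB bB' : (Tor (unitMod (D.F.P (D.K + 1))) × Fin (D.F.P (D.K + 1)).d) × o)
    (A : TowerData (D.F.P (D.K + 1)) o) (hA1 : (1 + r⁻¹) * ‖A‖ < rhoLev (D.F.P D.K) (o := o) (gammaV (Fintype.card o) (D.F.P D.K).d aA αA τA) aA)
    (hA2 : (1 + r⁻¹) * ‖A‖ < rhoLev (D.F.P (D.K + 1)) (o := o) (gammaV (Fintype.card o) (D.F.P (D.K + 1)).d aB αB τB) aB)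
    {ϱ : ℝ} (hϱ : (1 + r⁻¹) * ‖A‖ ≤ ϱ) :
    ∃ γ : ℂ → TwoRunChart D o, ∃ z₀ : ℂ, ‖z₀‖ ≤ r ∧ γ z₀ = relPair D (expChartT _ (towerDataOf (D.F.P (D.K + 1)) ι D.avB U.1) A) ∧
      (∀ x : ℝ, |x| < 1 → γ x ∈ relPair D '' realWindowOfRecord D ι ϱ) ∧
      DiffContOnCl ℂ (fun z => covAtTLev (D.F.P D.K) (cPr (D.F.P D.K)) (aPr (D.F.P D.K) aA) ΓA sA (chi _ (γ z).1).1 (chi _ (γ z).1).2 kA tA bA bA')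
        (Metric.ball (0 : ℂ) 1) ∧
      DiffContOnCl ℂ (fun z => covAtTLev (D.F.P (D.K + 1)) (cPr (D.F.P (D.K + 1))) (aPr (D.F.P (D.K + 1)) aB) ΓB sB (chi _ (γ z).2).1 (chi _ (γ z).2).2
        kB tB bB bB') (Metric.ball (0 : ℂ) 1) ∧
      (∀ z : ℂ, ‖z‖ ≤ 1 → ‖covAtTLev (D.F.P D.K) (cPr (D.F.P D.K)) (aPr (D.F.P D.K) aA) ΓA sA (chi _ (γ z).1).1 (chi _ (γ z).1).2 kA tA bA bA'‖
        ≤ (‖sA kA‖ * (16 * Fintype.card o * (((lev (D.F.P D.K).L kA : ℕ) : ℝ) ^ (D.F.P D.K).d)⁻¹) * (8 / gammaV (Fintype.card o) (D.F.P D.K).d aA αA τA) *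
            Real.exp (2 * kappaF (Fintype.card o) (D.F.P D.K).d aA (gammaV (Fintype.card o) (D.F.P D.K).d aA αA τA))) *
          Real.exp (-(kappaF (Fintype.card o) (D.F.P D.K).d aA (gammaV (Fintype.card o) (D.F.P D.K).d aA αA τA) *
            ldist (unitMod (D.F.P D.K)) bA.1.1 bA'.1.1))) ∧
      ∀ z : ℂ, ‖z‖ ≤ 1 → ‖covAtTLev (D.F.P (D.K + 1)) (cPr (D.F.P (D.K + 1))) (aPr (D.F.P (D.K + 1)) aB) ΓB sB (chi _ (γ z).2).1 (chi _ (γ z).2).2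
        kB tB bB bB'‖
        ≤ (‖sB kB‖ * (16 * Fintype.card o * (((lev (D.F.P (D.K + 1)).L kB : ℕ) : ℝ) ^ (D.F.P (D.K + 1)).d)⁻¹) *
              (8 / gammaV (Fintype.card o) (D.F.P (D.K + 1)).d aB αB τB) *
            Real.exp (2 * kappaF (Fintype.card o) (D.F.P (D.K + 1)).d aB (gammaV (Fintype.card o) (D.F.P (D.K + 1)).d aB αB τB))) *
          Real.exp (-(kappaF (Fintype.card o) (D.F.P (D.K + 1)).d aB (gammaV (Fintype.card o) (D.F.P (D.K + 1)).d aB αB τB) *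
            ldist (unitMod (D.F.P (D.K + 1))) bB.1.1 bB'.1.1)) := by
  have hcoA := coercive_vecOp_towerDataOf_of_regular _ ΓA ι D.avA hdist (D.carriers.transport U).1 haA hαA hτA hUA hTA
  rw [TwoRuns.carriers_transport_val, towerDataOf_transport] at hcoA
  exact hslice_covAtTLev_related_decay D ΓA ΓB (towerDataOf_mem_unitaryLev _ ι D.avB hι U.1) haA.le haB.le hcoA
    (coercive_vecOp_towerDataOf_of_regular _ ΓB ι D.avB hdist U.1 haB hαB hτB hUB hTB) hγVA hγVB hΓA hΓB hℓA hℓB sA sB h2A h2B hr kA kB tA tB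
    bA bA' bB bB' A hA1 hA2 ((realWindow_mono _ _ hϱ).trans (realWindow_subset_realWindowOfRecord D ι U ϱ))

end Record

end Summit.QuantumFields.BalabanUV.T4Continuum.SubstrateChartRelatedPairSpecies

end
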